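import Mathlib
import HarnessLib
import Literature.Analysis.FluidPDE.VorticityCalculus
import Summits.NavierStokesRegularity.NavierStokesRegularity.Theses.PoloidalWindowDoor
import Summits.NavierStokesRegularity.NavierStokesRegularity.Theses.LoopPeriodRatchet
import Summits.NavierStokesRegularity.NavierStokesRegularity.Theorems.PoloidalWindowDoorPoloidalWindowRigidityHotLoopsReduction
import Summits.NavierStokesRegularity.NavierStokesRegularity.Theorems.PoloidalWindowDoorPoloidalWindowRigidityFirstIntegral
import Summits.NavierStokesRegularity.NavierStokesRegularity.Theorems.PoloidalWindowDoorPoloidalWindowRigidityHotPlaneConst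
import Summits.NavierStokesRegularity.NavierStokesRegularity.Theorems.PoloidalWindowDoorPoloidalWindowRigidityZeroModeNoHotPlane
import Summits.NavierStokesRegularity.NavierStokesRegularity.Theorems.PoloidalWindowDoorPoloidalWindowRigidityHotSplitRidgeReductions
import Summits.NavierStokesRegularity.NavierStokesRegularity.Theorems.PoloidalWindowDoorPoloidalWindowRigidityHotSplitRidgeKernels
import Summits.NavierStokesRegularity.NavierStokesRegularity.Theorems.PoloidalWindowDoorPoloidalWindowRigidityHotSplitCells
import Summits.NavierStokesRegularity.NavierStokesRegularity.Theorems.PoloidalWindowDoorPoloidalWindowRigidityHotSplitComposition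
import Summits.NavierStokesRegularity.NavierStokesRegularity.Theorems.PoloidalWindowDoorPoloidalWindowRigidityLeafUniformPins
import Summits.NavierStokesRegularity.NavierStokesRegularity.Theorems.PoloidalWindowDoorPoloidalWindowRigidityLeafUniformHFlat
import Summits.NavierStokesRegularity.NavierStokesRegularity.Theorems.PoloidalWindowDoorPoloidalWindowRigidityLeafUniformVortexLine
import Summits.NavierStokesRegularity.NavierStokesRegularity.Theorems.PoloidalWindowDoorPoloidalWindowRigidityLeafUniformLeafGlobalLaw
import Summits.NavierStokesRegularity.NavierStokesRegularity.Theorems.PoloidalWindowDoorPoloidalWindowRigidityLeafUniformLeafEnds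
import Summits.NavierStokesRegularity.NavierStokesRegularity.Theorems.PoloidalWindowDoorPoloidalWindowRigidityLeafUniformHotRegularAlone
import Literature.Analysis.Calculus.RealAnalyticPlanarZeroSetBranches
import Summits.NavierStokesRegularity.NavierStokesRegularity.Theorems.PoloidalWindowDoorPoloidalWindowRigidityHotForestNoHotLoop
import Summits.NavierStokesRegularity.NavierStokesRegularity.Theorems.PoloidalWindowDoorPoloidalWindowRigidityHotForestSeparatrix
import Summits.NavierStokesRegularity.NavierStokesRegularity.Theorems.PoloidalWindowDoorPoloidalWindowRigidityHotForestCapturedEnd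
import Literature.Analysis.Calculus.RealAnalyticPlanarZeroSetBranchesOMinimal


/-!
# Crux `PoloidalWindowRigidity` (K2, stmt-NavierStokesRegularity-19708) + item `LrcModEntire` (stmt-20428) — LINE 20 `hot_forest` (v1.6)
# (IDEATOR seat ns-idea-8, generation 10; lens «barrier»; bears_on LADDER-NS N0, rung N0-LocalTubeDoorPoloidal, THICK column; targets the research
#  residue C2a′ `stub_cellC2aRidge` of LINE 15 `hot_split` v1.6 (tree `Lines/hot_split.lean` 0dd9c4b44e10), VERBATIM, and REFINES the four open cells of
#  LINE 18 `leaf_uniform` v1.3.1 (tree `Lines/leaf_uniform.lean` 36d7d6252884).)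

**v1.6 (maintenance, 2026-08-29 ≈08:20Z — NO statement changed; defs blockdiff-identical to v1.5):** V1 DISCHARGED one level down — every
`(hV1 : Literature.Analysis.Calculus.realAnalytic_planarZeroSet_conicStructure)` binder of v1.5 is now
`(hO : Literature.ModelTheory.ExponentialFields.VandendriesMiller1994_realAnExp_isOMinimal)` («`ℝ_an,exp` is o-minimal», van den Dries–Miller 1994, the
tree's NAMED FACT), with `v1_of_oMinimal hO := Literature.Analysis.Calculus.realAnalytic_planarZeroSet_conicStructure_of_realAnExp_isOMinimal hO`
(nsreg-typer g27: p707348 `PlanarConic.exists_branches_of_dim_le_one` PROVED + p707485) feeding `….coordPlane_fin3`; so the cone's ONLY Literature leaf is the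
o-minimality of `ℝ_an,exp`.  Sorry count unchanged.

**No summit and no crux is proved here.**  `PoloidalWindowRigidity_of_hotForest` / `LrcModEntire_of_hotForest` are CONDITIONAL on the sorried stubs,
exactly like every line of the column; the new content is the typed GLOBAL PLANAR STRUCTURE of the hot set (no hot cycles, the separatrix law, convergence
of captured ends) and a glued dichotomy of C2a′ into two cells that hold that structure in hand.

## Why this line (barrier-inversion on CENSUS-C2-g8, hot_loops-HL3-census C1–C6, NOTES_g9 B-g9-4/B-g9-6)

Every recorded attack on the ridge residue C2a′ is POINT-LOCAL (finite jets at the hot spot: consistent to all orders, Cartan–Kähler; census C1/C2, B-g8-1),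
AVERAGED (zero-mode / flux / BMO laws, blind to a codimension-2 hot set; B-g8-2/4), a wrong-signed COMPARISON (B-g8-5), or — since LINE 18 — LEAF-LOCAL
(invariants along one vortex leaf; the 2.5-D toy passes all of them, B-g9-6).  The statement «just outside» these classes that is still PROVABLE is the GLOBAL
TOPOLOGY of the hot set `H = {y ∈ P₀ : v₂(−1,y) = N}` as a subset of the plane, where two tools of a different kind bite:

* **F1a no hot cycle `NoHotCycle` (hand target, M).**  `H` contains no simple closed curve.  Proof: the tree's JORDAN CURVE THEOREM
  (`Literature.Topology.PlaneTopology.JordanCurveTheorem_holds`, `JordanCurveTheorem.of_periodic`; PROVED) gives the bounded complementary component `U` of a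
  hot loop in `P₀ ≅ ℂ`; `σw` (`w := v₂(−1,·)`, `σ = sign N`) is continuous on the compact closure and `= |N|` (its global maximum) on `∂U ⊆ H`; if
  `min_{cl U} σw = |N|` an open planar disc is hot, against the no-interior hypothesis of C2a′ (R4); otherwise the set of minimisers is a compact non-empty
  `K ⊂ U` and `(K, U × ℝ)` is an ISLAND BRACKET for `−σ·v₂(−1,·)` at height `z₀ = 0`, which `Peakless` forbids.  So the hot web is a FOREST.  (This is the
  first use of `Peakless` AWAY from the hot level: it kills interior minima of `σw` inside hot cycles, not only hot islands.)
* **F1b no homoclinic hot leaf `NoHotLoop` (hand target, S/M ⇐ F1a).**  An injective hot curve cannot converge to the same point at both ends (close the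
  curve up at `q` by `θ ↦ γ(tan π(θ − ½))`; continuity at the seam is the two limits).
* **F2 separatrix law `HotSeparatrix` (hand target, S/M).**  A complete vortex line of `ω(−1,·)` one of whose ends ACCUMULATES at a hot point `q` lies
  entirely in `H`: `w` and `y₂` are first integrals (frozen law `⟪∇v·ω, e₂⟫ = 0` + poloidality `ω₂ = 0`; tree `…LoopTangencyPin.apply_integralCurve_eq`,
  PROVED), hence constant along the line, and a cluster point forces the constants to be `w(q) = N`, `q₂ = 0`.  Consequence: EVERY separatrix of a hot
  vertex (a vorticity zero on `H`) is hot — the web is saturated under the vortex-line dynamics.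
* **V1 planar branch structure `PlanarZeroBranches` (LITERATURE FACT to vendor, L).**  The zero set of a real-analytic function on the plane near a zero
  `q` is, inside a small disc, `{q}` plus finitely many pairwise disjoint half-branches, each met exactly once by every small circle about `q` (local conic
  structure; Milnor, *Singular points of complex hypersurfaces* (1968) §3, Lemma 3.1 (curve selection) / Lemma 3.3 (branches)
  [corpus:book:milnor1969-singular-points-complex-hypersurfaces p.15–19] for the algebraic case; Łojasiewicz 1965 / Bierstone–Milman, Publ. IHES 67 (1988) §2–3
  for the analytic case [corpus:paper:arxiv-1806.05349 p.4]; curve selection also in Arnold–Gusein-Zade–Varchenko II [galaxy:panama:206295869161501]).  Not in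
  Mathlib (no Puiseux / semianalytic API; the tree's `Literature.Analysis.Calculus.ImplicitChart` covers only the regular case) — typed here as a Prop over an
  analytic `g : ℝ³ → ℝ` restricted to `P₀`, with the branches parametrised BY DISTANCE to `q`.
* **F3 captured ends converge `CapturedEndConverges` (hand target, M ⇐ V1).**  An injective complete hot leaf (`ω ≠ 0` along it) with a cluster point `q`,
  `ω(q) = 0`, at `+∞` CONVERGES to `q`: apply V1 to `g = w − N` at `q` (`g|_{P₀} ≢ 0` near `q` by R4); on a component `J` of `γ⁻¹(B_r(q))` the leaf runs inside ONE
  half-branch (they are separated in the punctured disc and `γ` never meets `q`), where `dist(γ, q)` is continuous and injective, hence strictly monotone; a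
  bounded `J` would have `dist → r` at both ends — impossible — so the component containing the late returns is `[T, ∞)` and `dist(γ τ, q) ↓ 0`.
  (R19 of LINE 18 recorded this convergence as «not claimed»; V1 is exactly the missing input, now typed.)

With R15/R16/R18/R19/R20 of LINE 18 (VERBATIM: global vortex lines, global leaf law, aloneness, injectivity + end dichotomy, flatness of null cluster points)
the complete hot leaf `Γ` through the arc of C2a′ has each end ESCAPING (leaving every compact set) or CONVERGING to a hot vertex, and the two research cells are

* **ESC-END `CellEscapingEnd` (OPEN):** some end of `Γ` escapes (the other arbitrary).  This single cell absorbs LINE 18's MORSE-ESC and FLAT-ESC and the mixed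
  «one end escaping, one captured» configurations; the Morse/flat type (`Δₕw(γ 0) ≠ 0` or `= 0`, constant along `Γ` by the ridge law) is left to the closer,
  who also holds the time pin, the Laplace sign on `H`, the no-cycle law and the separatrix law for this profile.
* **CONVERGENT-WEB `CellConvergentWeb` (OPEN):** `Γ` is a bounded HETEROCLINIC hot connection: `γ(τ) → q^±` as `τ → ±∞`, `q^± ∈ H` vorticity zeros, horizontally
  flat (`HFlat`), and `q⁺ ≠ q⁻` (F1b); the closer holds the no-cycle law (so no second hot leaf joins `q⁻` to `q⁺`, and no hot polygon exists anywhere) and the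
  separatrix law (every vortex line accumulating at `q^±` — in particular every other separatrix of these vertices — is hot, so the web continues through
  both vertices and, `H` having no compact isolated piece, is an unbounded tree).
  Why it might fail / why open: a bounded saddle connection inside an unbounded hot tree is consistent with every finite jet and with all leaf invariants; the
  missing input is dynamic (the ancient history of a heteroclinic vortex connection pinned at `w = N`) or combinatorial-at-infinity (the tree must still
  reach infinity through further edges: an induction on the web is conceivable but every vertex may be degenerate).

KERNEL (sorry-free, real arithmetic and logic only): `cellC2aRidge_of_forest : HotLapSign → HotTimePin → VortexLineGlobal → LeafGlobalLaw → HotRegularAlone →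
LeafEnds → HotFlatPointHFlat → NoHotCycle → NoHotLoop → HotSeparatrix → CapturedEndConverges → CellEscapingEnd → CellConvergentWeb → C2a′` (verbatim statement of
hot_split's `stub_cellC2aRidge`); then HL3′ ⇐ C2a′ ∧ C2b′ BY NAME (`…HotSplitCells.peaklessEmpty_of_ridges`), and the crux / the item BY NAME through
`…HotLoopsReduction.poloidalWindowRigidity_of_NUGRS_of_growth_of_peakless` / `…lrcModEntire_of_NUGRS_of_growth_of_peakless` with S0 and ⟨27893⟩ VERBATIM —
exactly LINE 18's plumbing.  `V1` enters the cone through `stub_capturedEndConverges_of_branches : V1 → F3` (the hand's real target) — the Literature obligation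
is typed and consumed, not hidden in a docstring.

## Barriers / Disproof used / honesty
- technique_class: plane topology (Jordan) + first integrals of the vortex-line flow + local conic structure of analytic plane curves + glued case split; no
  maximum principle beyond `Peakless`, no averaging, no finite-jet contradiction.
- Finite-jet / Cartan–Kähler barrier (Disproof (THICK) certificates; POLY-SECTOR-K2p5; census C1/C2): not engaged — F1–F3 compare DIFFERENT points of `H` and use
  the GLOBAL bound; the cells stay open — said so.  Codimension barrier (B-g8-2/4): the laws live on `H` and on the discs it bounds (F1a is the first law of
  the column that uses an OPEN planar set attached to `H`).  B-g8-5 (wrong-signed comparison): `Peakless` is applied to `−σv₂` on a Jordan interior, where the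
  sign is right.  B-g9-6 (2.5-D toy passes leaf-local laws): the toy's hot set is a straight line — ESC-END; the toy is not Type-I ancient, and no cell claims
  to exclude it kinematically.  `AxisymmetricTypeIExclusion`, `LeraySelfSimilarBlowupExclusion`, `HyperbolicSystemNoComparison`: not engaged.
- Disproof.lean: `stubTwisting_iff_residues` (THICK residue via the pinned form, as hot_split); `twist_eq_zero_of_constDir` / `not_singular_of_constDir_window`
  quantify over a WINDOW — no cell is an instance; no cell restates a refuted statement (negatives 22492 / I8a / I8c / I9 concern closed orbits and period
  ratchets; F1a is ABOUT the absence of closed hot curves and is proved, not assumed).  Each cell is WEAKER than C2a′ (more hypotheses, same conclusion).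
- The polynomial sector is EMPTY (Theorem P) and is not touched; S0 (`stub_localTHEmptyHypNUGRS`, (TH) column, lead K2-p3) and ⟨27893⟩ are VERBATIM and untouched.
-/

open scoped InnerProductSpace RealInnerProductSpace Laplacian

-- the summit and its single sub-problem share the name (CONVENTIONS §1)
set_option linter.dupNamespace false

namespace Summit.NavierStokesRegularity.NavierStokesRegularity.Cruxes.PoloidalWindowRigidity.HotForest

open Set Function MeasureTheory
open Literature.Analysis Literature.Analysis.FluidPDE
open Summit.NavierStokesRegularity.NavierStokesRegularity.Theses.LoopPeriodRatchet
open Summit.NavierStokesRegularity.NavierStokesRegularity.Theses.PoloidalWindowDoor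
open Summit.NavierStokesRegularity.NavierStokesRegularity.Theorems

/-! ## The hypothesis packages of HL3′ (VERBATIM hot_split v1.6 = leaf_uniform v1.3.1) -/

/-- **Pinned** — VERBATIM hot_split: Type-I decay, continuity, mild identity, div-free, e₃-poloidal, `N := v₂(−1,0) ≠ 0`, the global bound
`√(−t)|v₂| ≤ |N|`, `∇v₂(−1,0) = 0`, the time and Laplace pins. -/
def Pinned (C : ℝ) (v : ℝ → EuclideanSpace ℝ (Fin 3) → EuclideanSpace ℝ (Fin 3)) : Prop :=
  Literature.Analysis.FluidPDE.HasTypeITimeDecay C v ∧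
  ContinuousOn (Function.uncurry v) (Set.Iio (0 : ℝ) ×ˢ Set.univ) ∧
  (∀ s t : ℝ, s < t → t < 0 → ∀ x, v t x =
    Literature.Analysis.UnboundedOperators.heatExtension (v s) (t - s) x -
      Literature.Analysis.FluidPDE.oseenDuhamel 1 s v v t x) ∧
  (∀ t < 0, Literature.Analysis.FluidPDE.VectorCalculus.IsDivFree (v t)) ∧
  (∀ s < 0, ∀ y, ⟪Literature.Analysis.FluidPDE.curl (v s) y, EuclideanSpace.single 2 1⟫_ℝ = 0) ∧
  v (-1) 0 2 ≠ 0 ∧ (∀ t < 0, ∀ x, Real.sqrt (-t) * |v t x 2| ≤ |v (-1) 0 2|) ∧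
  (∀ h : EuclideanSpace ℝ (Fin 3), fderiv ℝ (v (-1)) 0 h 2 = 0) ∧
  (deriv (fun s => v s 0 2) (-1) = v (-1) 0 2 / 2 ∧ v (-1) 0 2 * (Δ (fun y => v (-1) y 2)) 0 ≤ 0)

/-- **ThickWindow** — VERBATIM hot_split. -/
def ThickWindow (v : ℝ → EuclideanSpace ℝ (Fin 3) → EuclideanSpace ℝ (Fin 3)) (W : Set (ℝ × EuclideanSpace ℝ (Fin 3))) : Prop :=
  IsOpen W ∧ W ⊆ Set.Iio (0 : ℝ) ×ˢ Set.univ ∧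
  (∀ z ∈ W, (Literature.Analysis.FluidPDE.curl (v z.1) z.2 ≠ 0 ∧
      (fderiv ℝ (v z.1) z.2 (EuclideanSpace.single 0 1) 2 ≠ 0 ∨ fderiv ℝ (v z.1) z.2 (EuclideanSpace.single 1 1) 2 ≠ 0) ∧
      (fderiv ℝ (v z.1) z.2 (EuclideanSpace.single 2 1) 0 ≠ 0 ∨ fderiv ℝ (v z.1) z.2 (EuclideanSpace.single 2 1) 1 ≠ 0)) ∧
    (fderiv ℝ (fun x => fderiv ℝ (v z.1) x (EuclideanSpace.single 2 1) 2) z.2 (EuclideanSpace.single 0 1) *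
          fderiv ℝ (v z.1) z.2 (EuclideanSpace.single 1 1) 2 -
        fderiv ℝ (fun x => fderiv ℝ (v z.1) x (EuclideanSpace.single 2 1) 2) z.2 (EuclideanSpace.single 1 1) *
          fderiv ℝ (v z.1) z.2 (EuclideanSpace.single 0 1) 2 ≠ 0)) ∧
  (∀ m : ℝ → ℝ → ℝ, ∀ W₁ : Set (ℝ × EuclideanSpace ℝ (Fin 3)), W₁ ⊆ W → IsOpen W₁ → W₁.Nonempty →
      ∃ z ∈ W₁, ∃ b : Fin 3, b ≠ 2 ∧
        fderiv ℝ (v z.1) z.2 (EuclideanSpace.single 2 1) b ≠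
          m z.1 (z.2 2) * fderiv ℝ (v z.1) z.2 (EuclideanSpace.single b 1) 2) ∧
  (∀ r : ℝ, 0 < r → (Metric.ball ((-1 : ℝ), (0 : EuclideanSpace ℝ (Fin 3))) r ∩ W).Nonempty)

/-- **Peakless** — VERBATIM hot_split: no island bracket of `σ·v₂(s,·)` on any horizontal plane at any time `s < 0`. -/
def Peakless (v : ℝ → EuclideanSpace ℝ (Fin 3) → EuclideanSpace ℝ (Fin 3)) : Prop :=
  ∀ (s z₀ σ M : ℝ) (K O : Set (EuclideanSpace ℝ (Fin 3))), s < 0 →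
    ((σ = 1 ∨ σ = -1) ∧ IsCompact K ∧ K.Nonempty ∧ (∀ y ∈ K, y 2 = z₀ ∧ σ * v s y 2 = M) ∧
      IsOpen O ∧ K ⊆ O ∧ (∀ y ∈ O, y 2 = z₀ → σ * v s y 2 ≤ M) ∧
      (∀ y ∈ O, y 2 = z₀ → σ * v s y 2 = M → y ∈ K)) → False

/-- The HOT SET of the hot-spot plane `P₀ = {y₂ = 0}` at time `−1` — VERBATIM hot_split: `H := {y : y₂ = 0, v₂(−1,y) = v₂(−1,0)}`. -/
def hotSet (v : ℝ → EuclideanSpace ℝ (Fin 3) → EuclideanSpace ℝ (Fin 3)) : Set (EuclideanSpace ℝ (Fin 3)) :=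
  {y | y 2 = 0 ∧ v (-1) y 2 = v (-1) 0 2}

/-! ## The leaf-uniform quantities (second derivatives of `w := v₂(−1,·)` in the column's nested-`fderiv` convention) -/

/-- `∂_b∂_a v₂(−1,·)(y)` — the second derivative of the vertical component of the time-`−1` slice, nested `fderiv` convention of the column. -/
noncomputable def hess (v : ℝ → EuclideanSpace ℝ (Fin 3) → EuclideanSpace ℝ (Fin 3)) (y a b : EuclideanSpace ℝ (Fin 3)) : ℝ :=
  fderiv ℝ (fun x => fderiv ℝ (fun x' => v (-1) x' 2) x a) y b

/-- `Δₕv₂(−1,·)(y) = ∂₀₀v₂ + ∂₁₁v₂` — the HORIZONTAL Laplacian of the vertical component at time `−1`. -/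
noncomputable def lapH (v : ℝ → EuclideanSpace ℝ (Fin 3) → EuclideanSpace ℝ (Fin 3)) (y : EuclideanSpace ℝ (Fin 3)) : ℝ :=
  hess v y (EuclideanSpace.single 0 1) (EuclideanSpace.single 0 1) + hess v y (EuclideanSpace.single 1 1) (EuclideanSpace.single 1 1)

/-- `I₂(y) := ∂_zz v₂ − |∇ₕ∂_z v₂|²/Δₕv₂` — the CURTAIN quantity (meaningful where `Δₕv₂ ≠ 0`). -/
noncomputable def curtain (v : ℝ → EuclideanSpace ℝ (Fin 3) → EuclideanSpace ℝ (Fin 3)) (y : EuclideanSpace ℝ (Fin 3)) : ℝ :=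
  hess v y (EuclideanSpace.single 2 1) (EuclideanSpace.single 2 1) -
    (hess v y (EuclideanSpace.single 2 1) (EuclideanSpace.single 0 1) ^ 2 +
      hess v y (EuclideanSpace.single 2 1) (EuclideanSpace.single 1 1) ^ 2) / lapH v y

/-! ## Horizontal flatness (VERBATIM leaf_uniform v1.3.1 = null_leaf v1.2) -/

/-- Horizontal flatness of the 2-jet of `w = v₂(−1,·)` at `y` (the same predicate as null_leaf's `HFlat`): `∂_a∂_b w(y) = ∂_b∂_a w(y) = 0` for `a` horizontal. -/
def HFlat (v : ℝ → EuclideanSpace ℝ (Fin 3) → EuclideanSpace ℝ (Fin 3)) (y : EuclideanSpace ℝ (Fin 3)) : Prop :=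
  ∀ a b : EuclideanSpace ℝ (Fin 3), a 2 = 0 → hess v y a b = 0 ∧ hess v y b a = 0


/-! ## Structure stubs shared VERBATIM with LINE 18 `leaf_uniform` v1.3.1 (same statements — one hand job closes both lines' copies)

v1.1 (2026-08-29, critic idea-crit-7 g6 BY-NAME notes 04:51Z/05:13Z): R9 `hotLapSign`, R10 `hotTimePin` (p694348 `…LeafUniformPins`), R15
`vortexLineGlobal` (`…LeafUniformVortexLine`), R19 `leafEnds` (p698325 `…LeafUniformLeafEnds`), R20 `hotFlatPointHFlat` (p697413 `…LeafUniformHFlat`)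
have LANDED in the tree as theorems of exactly these statements; their stubs below are discharged BY NAME (`exact <tree decl>`), never restated —
sorries 17 → 12 (R16 · R18 · V1 · F1a · F1b · F2 · F3 · ESC-END · CONVERGENT-WEB · C2b′ · S0 · wall).  v1.2 (2026-08-29 06:0xZ): R16 `leafGlobalLaw` has LANDED
too (`…LeafUniformCurtainCore` + `…LeafUniformLeafGlobalLaw`, ns-es-p1 g7) and is discharged BY NAME — sorries 12 → 11; statements byte-identical to v1.1.
v1.3 (2026-08-29 06:3xZ, critic idea-crit-7 g7 PRICE P1 + director-ns KEY-NS #198 ruling (2) = P2): V1's source of record is now the o-minimal LOCAL CONIC STRUCTURE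
theorem WITH THE DISTANCE CLAUSE (van den Dries 1998 Ch. 9 Thm. (2.3) [corpus:book:dries1998-tame-topology-o-minimal-structures p.174] = Coste Thm. 4.10
[corpus:paper:arxiv-1806.05349 p.4 Prop. 2.3]); the DRAFT TEXT of the Literature fact to vendor is the new planar, intrinsic `def PlanarAnalyticConicStructure`
(V1⁰, fact-grade stub `stub_planarConicStructure`), and V1 `PlanarZeroBranches` is now DERIVED from it (`planarZeroBranches_of_conic`, PROVED: the affine
isometric chart `planeEmb q` of the hot-spot plane); all other statements byte-identical to v1.2; sorries 11 (V1⁰ · R18 · F1a · F1b · F2 · F3 · ESC-END ·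
CONVERGENT-WEB · C2b′ · S0 · wall).  v1.4 (06:2xZ): R18 `hotRegularAlone` LANDED (p701832 + p701918, ns-es-p1 g7) and DISCHARGED BY NAME — sorries 11 → 10 (V1⁰ · F1a · F1b · F2 ·
F3 · ESC-END · CONVERGENT-WEB · C2b′ · S0 · wall); statements byte-identical to v1.3.  v1.5 (generation 11, 07:4xZ — MAINTENANCE, wiring only; statements of
every item byte-identical): BY NAME from the tree F1a `noHotCycle` (p701982) · F1b `noHotLoop` (p702250) · F2 `hotSeparatrix` (ns-k2-port-2 g4) · F3
`capturedEndConverges_of_branches` (p702676); V1 := `Literature.Analysis.Calculus.realAnalytic_planarZeroSet_conicStructure.coordPlane_fin3 hV1` (p703245) — the Literature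
NAMED FACT enters AS THE HYPOTHESIS `hV1` of `capturedEndConverges_holds`, `stub_cellC2aRidge`, `hotForest_peaklessEmpty`, `PoloidalWindowRigidity_of_hotForest`,
`LrcModEntire_of_hotForest` (named debt +1, no sorry); V1⁰ + transport deleted (dead code).  Sorries 10 → 5 = ESC-END · CONVERGENT-WEB · C2b′ · S0 · wall. -/

/-- **R9 `HotLapSign` (PROVABLE, S; LOAD-BEARING).**  At every hot point `N·Δₕv₂(−1,y) ≤ 0` (`y` maximises `σv₂(−1,·)` over `ℝ³` by the global
bound at `t = −1`, so every pure second derivative of `σv₂(−1,·)` at `y` is `≤ 0`; tree `contDiff_slice`, second-order test as in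
`…LrcModEntireHigherOrderMaxTest` / `…ThreadPins`). -/
def HotLapSign : Prop :=
  ∀ (C : ℝ) (v : ℝ → EuclideanSpace ℝ (Fin 3) → EuclideanSpace ℝ (Fin 3)), Pinned C v →
    ∀ y ∈ hotSet v, v (-1) 0 2 * lapH v y ≤ 0

/-- **stub R9** (PROVABLE, S). -/
theorem stub_hotLapSign : HotLapSign := by
  -- LANDED in the tree (closes the verbatim leaf_uniform item AS TYPED); discharged BY NAME, never restated.
  exact Summit.NavierStokesRegularity.NavierStokesRegularity.Theorems.PoloidalWindowDoorPoloidalWindowRigidityLeafUniformPins.hotLapSign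

/-- **R10 `HotTimePin` (PROVABLE, S/M; LOAD-BEARING: handed to both cells).**  The time pin holds at EVERY hot point:
`∂ₜv₂(−1,y) = N/2` for `y ∈ H` (each hot point maximises `√(−t)σv₂` over `(−∞,0) × ℝ³`; differentiability in `t` of the classical solution; tree
pattern `…HotSpot.hotSpot_firstOrder`).  With vertical NS at a critical point of `v₂`: `−∂_z p(−1,y) = N/2 − Δv₂(−1,y)` on all of `H`.
v1.1 note for the hand prover (critic A2): the statement uses `deriv`, so the proof MUST route through time-differentiability of the mild Type-I
ancient solution at `t = −1` (tree `Literature.Analysis.FluidPDE.TypeIAncientMildClassical` / the `…HotSpot.hotSpot_firstOrder` pattern); with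
`deriv`-junk alone the statement would read `0 = N/2`, false — size S/M, not S. -/
def HotTimePin : Prop :=
  ∀ (C : ℝ) (v : ℝ → EuclideanSpace ℝ (Fin 3) → EuclideanSpace ℝ (Fin 3)), Pinned C v →
    ∀ y ∈ hotSet v, deriv (fun s => v s y 2) (-1) = v (-1) 0 2 / 2

/-- **stub R10** (PROVABLE, S/M). -/
theorem stub_hotTimePin : HotTimePin := by
  -- LANDED in the tree (closes the verbatim leaf_uniform item AS TYPED); discharged BY NAME, never restated.
  exact Summit.NavierStokesRegularity.NavierStokesRegularity.Theorems.PoloidalWindowDoorPoloidalWindowRigidityLeafUniformPins.hotTimePin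

/-- **R15 `VortexLineGlobal` (PROVABLE, M; support).**  Through every point there is a GLOBAL integral curve of `ω(−1,·)`: the field is `C¹`
(`slice_facts` / `contDiff_curl`) and BOUNDED on `ℝ³`: the ONE source (v1.3.1, critic's light ask) is the tree's PROVED
`Literature.Analysis.FluidPDE.exists_tube_extension_of_typeI_ancient_mild` (TypeIAncientMildTubeAnalyticity.lean — the slice `v(−1,·)` extends holomorphically to a
UNIFORM complex tube of radius `r > 0` with a UNIFORM bound `B`; its hypotheses are `Pinned`'s first four conjuncts + `C¹` slices from `slice_facts`), whence
`sup‖Dv(−1,·)‖ ≤ B/r` by the Cauchy estimate on each coordinate disc and `sup‖ω(−1,·)‖ < ∞`; so maximal solutions of `γ′ = ω(γ)` (Mathlib Picard–Lindelöf +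
continuation under `‖γ′‖ ≤ sup‖ω‖`) live on all of `ℝ`. -/
def VortexLineGlobal : Prop :=
  ∀ (C : ℝ) (v : ℝ → EuclideanSpace ℝ (Fin 3) → EuclideanSpace ℝ (Fin 3)), Pinned C v →
    ∀ y : EuclideanSpace ℝ (Fin 3), ∃ γ : ℝ → EuclideanSpace ℝ (Fin 3), γ 0 = y ∧ ∀ τ : ℝ, HasDerivAt γ (Literature.Analysis.FluidPDE.curl (v (-1)) (γ τ)) τ

/-- **stub R15** (hand target). -/
theorem stub_vortexLineGlobal : VortexLineGlobal := by
  -- LANDED in the tree (closes the verbatim leaf_uniform item AS TYPED); discharged BY NAME, never restated.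
  exact Summit.NavierStokesRegularity.NavierStokesRegularity.Theorems.PoloidalWindowDoorPoloidalWindowRigidityLeafUniformVortexLine.vortexLineGlobal

/-- **R16 `LeafGlobalLaw` (PROVABLE, L; support — the GLOBAL form of R2 + R8 (+ R11 on Morse leaves) along a complete vortex line; v1.3: the Morse
hypothesis now guards only the curtain law).**  Along a global integral curve `γ` of `ω(−1,·)` starting at a hot point with `ω ≠ 0`: (a) every `γ τ` is hot
(first integrals `(γ τ)₂` and `w(γ τ)`: poloidality + frozen law, tree `…LoopTangencyPin.apply_integralCurve_eq`), `ω(γ τ) ≠ 0` (ODE uniqueness: an integral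
curve through a non-zero of a `C¹` field never meets a zero) and the ridge law `Δₕw(γ τ)‖ω(γ 0)‖² = Δₕw(γ 0)‖ω(γ τ)‖²` (R8's pointwise Wronskian identity at
every `τ`, constancy on the connected line); (b) if moreover `Δₕw(γ 0) ≠ 0` (MORSE; then `Δₕw ≠ 0` along `γ` by (a)), the curtain law `curtain(γ τ) = curtain(γ 0)`
(R11's identity).  The calculus is R8/R11's — one hand proves the pointwise identities once and gets R8, R11 and R16 together. -/
def LeafGlobalLaw : Prop :=
  ∀ (C : ℝ) (v : ℝ → EuclideanSpace ℝ (Fin 3) → EuclideanSpace ℝ (Fin 3)), Pinned C v →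
    (∀ s < 0, ∀ y, ⟪fderiv ℝ (v s) y (Literature.Analysis.FluidPDE.curl (v s) y), EuclideanSpace.single 2 1⟫_ℝ = 0) →
    (∀ y ∈ hotSet v, fderiv ℝ (fun x => v (-1) x 2) y = 0) →
    ∀ γ : ℝ → EuclideanSpace ℝ (Fin 3), (∀ τ : ℝ, HasDerivAt γ (Literature.Analysis.FluidPDE.curl (v (-1)) (γ τ)) τ) → γ 0 ∈ hotSet v →
      Literature.Analysis.FluidPDE.curl (v (-1)) (γ 0) ≠ 0 →
      (∀ τ : ℝ, γ τ ∈ hotSet v ∧ Literature.Analysis.FluidPDE.curl (v (-1)) (γ τ) ≠ 0 ∧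
        lapH v (γ τ) * ‖Literature.Analysis.FluidPDE.curl (v (-1)) (γ 0)‖ ^ 2 = lapH v (γ 0) * ‖Literature.Analysis.FluidPDE.curl (v (-1)) (γ τ)‖ ^ 2) ∧
      (lapH v (γ 0) ≠ 0 → ∀ τ : ℝ, curtain v (γ τ) = curtain v (γ 0))

/-- **R16 — DISCHARGED BY NAME (v1.2)** from the landed `…LeafUniformLeafGlobalLaw.leafGlobalLaw` (ns-es-p1 g7, `--supports 19708` helper; R16 VERBATIM with
the line's `Pinned` / `hotSet` / `lapH` / `hess` / `curtain` unfolded — es-p1's by-name wiring), never restated. -/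
theorem stub_leafGlobalLaw : LeafGlobalLaw := fun C v hP hfr hcrit γ hγ h0 hne =>
  PoloidalWindowDoorPoloidalWindowRigidityLeafUniformLeafGlobalLaw.leafGlobalLaw C v hP hfr hcrit γ hγ h0 hne

/-- **R18 `HotRegularAlone` (PROVABLE, L; support — near a REGULAR hot point the hot set is ONE vortex arc; STRUCT-g9-2 (W1)).**  The slice `v(−1,·)` is
real-analytic on `ℝ³` (tree, PROVED: `IsTypeIAncientMild.analyticOnNhd_slice_univ` ∘ `…PoloidalWindowDoorPoloidalWindowRigidityWindow.isTypeIAncientMild_of_class`);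
near a hot `y` with `ω(y) ≠ 0`, in the plane `P₀` the frozen law makes `w := v₂(−1,·)` a function of the local stream value, `w = Φ ∘ ψ` with `∇ψ = (ω₁, −ω₀) ≠ 0`
(flow box; analytic implicit chart, tree `Literature.Analysis.Calculus.ImplicitChart` `analyticAt_implicitFunction`), `Φ` analytic in one variable with a local
maximum `N` at `ψ₀`; `Φ ≢ N` near `ψ₀` (else a plane-neighbourhood of `y` is hot, contradicting the no-interior hypothesis R4), so by the one-variable identity
theorem (Mathlib `AnalyticAt.eventually_eq_or_eventually_ne`) `ψ₀` is isolated in `{Φ = N}`: `Φ = N − a(ψ−ψ₀)^{2k}(1+…)`, `a ≠ 0`, `k ≥ 1` — the pair `(k, a)` is a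
LEAF INVARIANT extending R8 (`k = 1 ⇔` MORSE with `c = Φ''(ψ₀)`; FLAT `⇔ k ≥ 2`) — and the hot set near `y` is exactly the arc `{ψ = ψ₀}` = the vortex arc through
`y`.  Holds for MORSE and FLAT leaves alike; it is the only place analyticity enters this line. -/
def HotRegularAlone : Prop :=
  ∀ (C : ℝ) (v : ℝ → EuclideanSpace ℝ (Fin 3) → EuclideanSpace ℝ (Fin 3)), Pinned C v →
    (∀ s < 0, ∀ y, ⟪fderiv ℝ (v s) y (Literature.Analysis.FluidPDE.curl (v s) y), EuclideanSpace.single 2 1⟫_ℝ = 0) →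
    (∀ y ∈ hotSet v, ∀ r : ℝ, 0 < r →
      ∃ y' : EuclideanSpace ℝ (Fin 3), y' 2 = 0 ∧ dist y' y < r ∧ v (-1) y' 2 ≠ v (-1) 0 2) →
    (∀ y ∈ hotSet v, Literature.Analysis.FluidPDE.curl (v (-1)) y ≠ 0 → ∃ r : ℝ, 0 < r ∧ ∃ (α : ℝ → EuclideanSpace ℝ (Fin 3)) (δ : ℝ), 0 < δ ∧ α 0 = y ∧
        (∀ s ∈ Set.Ioo (-δ) δ, HasDerivAt α (Literature.Analysis.FluidPDE.curl (v (-1)) (α s)) s) ∧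
        ∀ y' ∈ hotSet v, dist y' y < r → ∃ s ∈ Set.Ioo (-δ) δ, y' = α s)

/-- **R18 — DISCHARGED BY NAME** from the landed `…Theorems.PoloidalWindowDoorPoloidalWindowRigidityLeafUniformHotRegularAlone.hotRegularAlone`
(p701832 `…LeafUniformAloneCore` + p701918, ns-es-p1 g7, `--supports 19708` helper; R18 VERBATIM with `Pinned` / `hotSet` unfolded), never restated. -/
theorem stub_hotRegularAlone : HotRegularAlone := fun C v hP hfr hni y hy hω =>
  Summit.NavierStokesRegularity.NavierStokesRegularity.Theorems.PoloidalWindowDoorPoloidalWindowRigidityLeafUniformHotRegularAlone.hotRegularAlone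
    C v hP hfr hni y hy hω

/-- **R19 `LeafEnds` (PROVABLE, M/L; support — topological dynamics of a complete hot leaf, MORSE OR FLAT; v1.3 replaces v1.2's Morse-only R17).**  Given
(a) of R16 along a complete vortex line `γ`, local aloneness of regular hot points (R18's conclusion), a closed hot set and no compact isolated hot piece (R3):
(i) `γ` is INJECTIVE — a non-injective solution of the autonomous `C¹` ODE is periodic, its image is compact and, by aloneness at each of its points, relatively
open in `H`: a compact isolated hot piece; (ii) for each end (`atTop`, `atBot`) either `γ` leaves every compact set or it has a cluster point `q`; then `q ∈ H`
(closed), `ω(q) = 0` (were `ω(q) ≠ 0`, aloneness at `q` puts the returning points `γ τ_k` on the single arc through `q`, and ODE uniqueness + injectivity force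
`τ_k → τ*` with `γ τ* = q`, against `τ_k → ∞`), and `Δₕw(q) = 0` (the ridge law gives `Δₕw(γ τ_k) = Δₕw(γ 0)‖ω(γ τ_k)‖²/‖ω(γ 0)‖² → 0` by continuity of `ω`
and of `Δₕw` for the `C²` slice).  (Under the analytic web — Łojasiewicz's planar structure theorem, not used here — the captured end even CONVERGES to `q`
along an analytic arc of finite length; not claimed.)  PLANARITY (v1.3.1, answers critic P1 on v1.2's R17): the hot set is PLANAR BY DEFINITION
(`hotSet v ⊆ P₀ = {y₂ = 0}`) and R3 / aloneness / isolation are statements about that planar set, so the only normal direction is the horizontal `n` and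
`∂ₙ∂ₙw = Δₕw` (Morse) resp. the finite transversal order `2k` (R18) decide aloneness INSIDE `P₀`; a hot 2-sheet of `ℝ³` through the leaf with tangent
`αn + βe_z`, `β ≠ 0` (2-jet-consistent when `Δₕw·curtain = 0`) meets `P₀` transversally in the leaf itself and does not affect R3 — no Morse–Bott analysis on
`span(n, e_z)` and no `curtain ≠ 0` hypothesis is needed. -/
def LeafEnds : Prop :=
  ∀ (C : ℝ) (v : ℝ → EuclideanSpace ℝ (Fin 3) → EuclideanSpace ℝ (Fin 3)), Pinned C v → IsClosed (hotSet v) →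
    (∀ K O : Set (EuclideanSpace ℝ (Fin 3)), IsCompact K → K.Nonempty → K ⊆ hotSet v → IsOpen O → K ⊆ O →
      O ∩ hotSet v ⊆ K → False) →
    (∀ y ∈ hotSet v, Literature.Analysis.FluidPDE.curl (v (-1)) y ≠ 0 → ∃ r : ℝ, 0 < r ∧ ∃ (α : ℝ → EuclideanSpace ℝ (Fin 3)) (δ : ℝ), 0 < δ ∧ α 0 = y ∧
        (∀ s ∈ Set.Ioo (-δ) δ, HasDerivAt α (Literature.Analysis.FluidPDE.curl (v (-1)) (α s)) s) ∧
        ∀ y' ∈ hotSet v, dist y' y < r → ∃ s ∈ Set.Ioo (-δ) δ, y' = α s) →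
    ∀ γ : ℝ → EuclideanSpace ℝ (Fin 3), (∀ τ : ℝ, HasDerivAt γ (Literature.Analysis.FluidPDE.curl (v (-1)) (γ τ)) τ) →
      (∀ τ : ℝ, γ τ ∈ hotSet v ∧ Literature.Analysis.FluidPDE.curl (v (-1)) (γ τ) ≠ 0 ∧
        lapH v (γ τ) * ‖Literature.Analysis.FluidPDE.curl (v (-1)) (γ 0)‖ ^ 2 = lapH v (γ 0) * ‖Literature.Analysis.FluidPDE.curl (v (-1)) (γ τ)‖ ^ 2) →
      Function.Injective γ ∧
      (Filter.Tendsto γ Filter.atTop (Filter.cocompact (EuclideanSpace ℝ (Fin 3))) ∨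
        ∃ q : EuclideanSpace ℝ (Fin 3), MapClusterPt q Filter.atTop γ ∧ q ∈ hotSet v ∧ Literature.Analysis.FluidPDE.curl (v (-1)) q = 0 ∧ lapH v q = 0) ∧
      (Filter.Tendsto γ Filter.atBot (Filter.cocompact (EuclideanSpace ℝ (Fin 3))) ∨
        ∃ q : EuclideanSpace ℝ (Fin 3), MapClusterPt q Filter.atBot γ ∧ q ∈ hotSet v ∧ Literature.Analysis.FluidPDE.curl (v (-1)) q = 0 ∧ lapH v q = 0)

/-- **stub R19** (hand target). -/
theorem stub_leafEnds : LeafEnds := by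
  -- LANDED in the tree (closes the verbatim leaf_uniform item AS TYPED); discharged BY NAME, never restated.
  exact Summit.NavierStokesRegularity.NavierStokesRegularity.Theorems.PoloidalWindowDoorPoloidalWindowRigidityLeafUniformLeafEnds.leafEnds

/-- **R20 `HotFlatPointHFlat` (PROVABLE, S/M; support).**  A hot point with `Δₕw = 0` is horizontally FLAT: `y` is a global extremum of `w = v₂(−1,·)` on `ℝ³`
(the pinned bound at `t = −1`), so `σ·Hess w(y) ≤ 0` (`σ = sign N`; `C²` slice, symmetric nested `fderiv`s — Mathlib `second_derivative_symmetric`); a negative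
semidefinite horizontal block with zero trace vanishes, and the `2×2` minors on `(a, e₂)` then kill the mixed entries `∂_a∂_z w`.  In particular EVERY point of a flat
leaf, and every captured end point (R19: `Δₕw(q) = 0`), is `HFlat`. -/
def HotFlatPointHFlat : Prop :=
  ∀ (C : ℝ) (v : ℝ → EuclideanSpace ℝ (Fin 3) → EuclideanSpace ℝ (Fin 3)), Pinned C v → ∀ y ∈ hotSet v, lapH v y = 0 → HFlat v y

/-- **stub R20** (hand target). -/
theorem stub_hotFlatPointHFlat : HotFlatPointHFlat := by
  -- LANDED in the tree (closes the verbatim leaf_uniform item AS TYPED); discharged BY NAME, never restated.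
  exact Summit.NavierStokesRegularity.NavierStokesRegularity.Theorems.PoloidalWindowDoorPoloidalWindowRigidityLeafUniformHFlat.hotFlatPointHFlat

/-! ## v1 (LINE 20) — the GLOBAL PLANAR STRUCTURE of the hot set: no cycles, separatrices, convergent ends -/

/-- **V1 `PlanarZeroBranches` (LITERATURE NAMED FACT — VENDORED p703245 as `Literature.Analysis.Calculus.realAnalytic_planarZeroSet_conicStructure` with the PROVED corollary
`….coordPlane_fin3` = this statement verbatim; support — local conic structure of planar real-analytic zero sets).**  For `g : ℝ³ → ℝ`
real-analytic and a zero `q ∈ P₀ = {y₂ = 0}` near which `g|_{P₀}` is not identically zero, there are `r > 0`, `m : ℕ` and `m` HALF-BRANCHES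
`β i : [0,1) → P₀`, continuous, `β i 0 = q`, PARAMETRISED BY DISTANCE (`dist (β i s) q = r·s`), inside the zero set, pairwise disjoint off `q`, covering every
zero of `g|_{P₀}` in the punctured disc of radius `r` (`m = 0` iff `q` is an isolated zero).  SOURCE OF RECORD (v1.3, critic P1 / KEY-NS #198 (2)): the
o-minimal LOCAL CONIC STRUCTURE theorem with the distance clause `‖φ(x) − p‖ = ‖x − p‖`, van den Dries 1998 Ch. 9 Thm. (2.3) [corpus:book:dries1998-tame-topology-
o-minimal-structures p.174] (= Coste Thm. 4.10 [corpus:paper:arxiv-1806.05349 p.4 Prop. 2.3]; curve selection Shiota I.2.1.7 [ibid. Prop. 2.2]; Bierstone–Milman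
1988 §2), in `ℝ_an`, plus finiteness of `{g = 0} ∩ S(q,ε)` by the identity theorem — the PLANAR intrinsic statement is the Literature `def`
`realAnalytic_planarZeroSet_conicStructure` (closed-disc form) with PROVED corollaries `.openDisc` (= the former draft V1⁰) and `.coordPlane_fin3` (= V1);
Milnor 1968 Thm. 2.10 / Lemma 3.3 cover the ALGEBRAIC case only and are not the anchor.  Not in Mathlib.  **v1.5: V1 := `….coordPlane_fin3 hV1`
with the fact as the hypothesis `hV1`; V1⁰ and the transport deleted.**  Consumed by the hand proving F3 `CapturedEndConverges` (V1 as HYPOTHESIS, fact-free). -/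
def PlanarZeroBranches : Prop :=
  ∀ (g : EuclideanSpace ℝ (Fin 3) → ℝ), AnalyticOnNhd ℝ g Set.univ →
    ∀ q : EuclideanSpace ℝ (Fin 3), q 2 = 0 → g q = 0 →
      (∀ r : ℝ, 0 < r → ∃ y : EuclideanSpace ℝ (Fin 3), y 2 = 0 ∧ dist y q < r ∧ g y ≠ 0) →
      ∃ r : ℝ, 0 < r ∧ ∃ (m : ℕ) (β : Fin m → ℝ → EuclideanSpace ℝ (Fin 3)),
        (∀ i, ContinuousOn (β i) (Set.Ico 0 1) ∧ β i 0 = q ∧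
          ∀ s ∈ Set.Ico (0 : ℝ) 1, (β i s) 2 = 0 ∧ g (β i s) = 0 ∧ dist (β i s) q = r * s) ∧
        (∀ i j, ∀ s ∈ Set.Ioo (0 : ℝ) 1, β i s = β j s → i = j) ∧
        (∀ y : EuclideanSpace ℝ (Fin 3), y 2 = 0 → g y = 0 → 0 < dist y q → dist y q < r →
          ∃ i, ∃ s ∈ Set.Ioo (0 : ℝ) 1, y = β i s)

/-- **V1 discharged (v1.6)**: the planar conic-structure fact now FOLLOWS from the tree's named fact «`ℝ_an,exp` is o-minimal»
(van den Dries–Miller 1994) by nsreg-typer g27's landed p707348 `PlanarConic.exists_branches_of_dim_le_one` + p707485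
`Literature.Analysis.Calculus.realAnalytic_planarZeroSet_conicStructure_of_realAnExp_isOMinimal`; so the only Literature leaf in the cone is `hO`. -/
theorem v1_of_oMinimal (hO : Literature.ModelTheory.ExponentialFields.VandendriesMiller1994_realAnExp_isOMinimal) :
    Literature.Analysis.Calculus.realAnalytic_planarZeroSet_conicStructure :=
  Literature.Analysis.Calculus.realAnalytic_planarZeroSet_conicStructure_of_realAnExp_isOMinimal hO

/-- **V1 on this line — BY NAME from the Literature (v1.5).**  The NAMED FACT `Literature.Analysis.Calculus.realAnalytic_planarZeroSet_conicStructure`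
(van den Dries 1998 Ch. 9 (2.3), local conic structure of planar real-analytic zero sets; vendored p703245, nsreg-typer g27) enters AS A HYPOTHESIS `hV1`
(a named Literature debt, not a sorry); its PROVED corollary `….coordPlane_fin3` is this statement VERBATIM (critic idea-crit-7 g7 06:45:35Z (a)).  The former
draft V1⁰ `PlanarAnalyticConicStructure` and the in-file chart transport `planarZeroBranches_of_conic` are retired (dead code, deleted). -/
theorem stub_planarZeroBranches (hO : Literature.ModelTheory.ExponentialFields.VandendriesMiller1994_realAnExp_isOMinimal) : PlanarZeroBranches :=
  Literature.Analysis.Calculus.realAnalytic_planarZeroSet_conicStructure.coordPlane_fin3 (v1_of_oMinimal hO)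

/-- **F1a `NoHotCycle` (PROVABLE, M; LOAD-BEARING).**  A pinned, peakless profile whose hot set has no planar interior point carries NO HOT CYCLE: no
continuous `1`-periodic curve, injective on `[0,1)`, runs inside `hotSet v`.  Proof (file header): Jordan (tree `JordanCurveTheorem_holds.of_periodic` on
`θ ↦ ⟨c θ 0, c θ 1⟩ : ℂ`) ⇒ bounded interior `U`; `σ·v₂(−1,·)` on the compact planar closure attains a minimum `m`; `m = |N|` makes an open planar disc hot
(contradicting the no-interior hypothesis at a point of `U`, which is then hot); `m < |N|` makes the minimisers a compact `K ⊂ U` and `(K, {y : (y₀,y₁) ∈ U})`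
an island bracket of `−σ·v₂(−1,·)` at `z₀ = 0`, `s = −1`, against `Peakless`.  Slice continuity from `Pinned` (tree `slice_facts`). -/
def NoHotCycle : Prop :=
  ∀ (C : ℝ) (v : ℝ → EuclideanSpace ℝ (Fin 3) → EuclideanSpace ℝ (Fin 3)), Pinned C v → Peakless v →
    (∀ y ∈ hotSet v, ∀ r : ℝ, 0 < r →
      ∃ y' : EuclideanSpace ℝ (Fin 3), y' 2 = 0 ∧ dist y' y < r ∧ v (-1) y' 2 ≠ v (-1) 0 2) →
    ∀ c : ℝ → EuclideanSpace ℝ (Fin 3), Continuous c → (∀ θ : ℝ, c (θ + 1) = c θ) → Set.InjOn c (Set.Ico 0 1) →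
      (∀ θ : ℝ, c θ ∈ hotSet v) → False

/-- **F1a BY NAME (v1.5)** — K2-p2 g14's p701982 `…Theorems.PoloidalWindowDoorPoloidalWindowRigidityHotForestNoHotCycle.noHotCycle` (this statement with
`Pinned` / `Peakless` / `hotSet` δ-unfolded; closes by unfolding; never restated). -/
theorem stub_noHotCycle : NoHotCycle :=
  Summit.NavierStokesRegularity.NavierStokesRegularity.Theorems.PoloidalWindowDoorPoloidalWindowRigidityHotForestNoHotCycle.noHotCycle

/-- **F1b `NoHotLoop` (PROVABLE, S/M ⇐ F1a; LOAD-BEARING).**  An injective continuous hot curve avoiding `q` cannot converge to `q` at BOTH ends (`q ∈ H` by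
closedness of the slice's level set; close the curve up at `q`: `θ ↦ γ (tan (π(θ − ½)))` on `(0,1)`, `q` at the integers — continuous, `1`-periodic,
injective on `[0,1)`; F1a). -/
def NoHotLoop : Prop :=
  ∀ (C : ℝ) (v : ℝ → EuclideanSpace ℝ (Fin 3) → EuclideanSpace ℝ (Fin 3)), Pinned C v → Peakless v →
    (∀ y ∈ hotSet v, ∀ r : ℝ, 0 < r →
      ∃ y' : EuclideanSpace ℝ (Fin 3), y' 2 = 0 ∧ dist y' y < r ∧ v (-1) y' 2 ≠ v (-1) 0 2) →
    ∀ γ : ℝ → EuclideanSpace ℝ (Fin 3), Continuous γ → Function.Injective γ → (∀ τ : ℝ, γ τ ∈ hotSet v) →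
      ∀ q : EuclideanSpace ℝ (Fin 3), (∀ τ : ℝ, γ τ ≠ q) →
        Filter.Tendsto γ Filter.atTop (nhds q) → Filter.Tendsto γ Filter.atBot (nhds q) → False

/-- **F1b BY NAME (v1.5)** — K2-p2 g14's p702250 `…Theorems.PoloidalWindowDoorPoloidalWindowRigidityHotForestNoHotLoop.noHotLoop`. -/
theorem stub_noHotLoop : NoHotLoop :=
  Summit.NavierStokesRegularity.NavierStokesRegularity.Theorems.PoloidalWindowDoorPoloidalWindowRigidityHotForestNoHotLoop.noHotLoop

/-- **F2 `HotSeparatrix` (PROVABLE, S/M; LOAD-BEARING — the separatrix law).**  A complete integral curve of `ω(−1,·)` one of whose ends has a CLUSTER POINT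
in the hot set lies entirely in the hot set: `y ↦ v₂(−1,y)` and `y ↦ y₂` are first integrals (frozen law at `s = −1` + poloidality from `Pinned`; tree
`…LoopTangencyPin.apply_integralCurve_eq` on every `(−T, T)`), so both are constant along `γ`, and along a subsequence `γ τ_k → q` continuity gives the
constants `v₂(−1,q) = N` and `q₂ = 0`. -/
def HotSeparatrix : Prop :=
  ∀ (C : ℝ) (v : ℝ → EuclideanSpace ℝ (Fin 3) → EuclideanSpace ℝ (Fin 3)), Pinned C v →
    (∀ s < 0, ∀ y, ⟪fderiv ℝ (v s) y (Literature.Analysis.FluidPDE.curl (v s) y), EuclideanSpace.single 2 1⟫_ℝ = 0) →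
    ∀ γ : ℝ → EuclideanSpace ℝ (Fin 3), (∀ τ : ℝ, HasDerivAt γ (Literature.Analysis.FluidPDE.curl (v (-1)) (γ τ)) τ) →
      ∀ q ∈ hotSet v, (MapClusterPt q Filter.atTop γ ∨ MapClusterPt q Filter.atBot γ) → ∀ τ : ℝ, γ τ ∈ hotSet v

/-- **F2 BY NAME (v1.5)** — ns-k2-port-2 g4's `…Theorems.PoloidalWindowDoorPoloidalWindowRigidityHotForestSeparatrix.hotSeparatrix` (first integrals
`y₂`, `v₂(−1,·)` along the leaf + closedness). -/
theorem stub_hotSeparatrix : HotSeparatrix :=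
  Summit.NavierStokesRegularity.NavierStokesRegularity.Theorems.PoloidalWindowDoorPoloidalWindowRigidityHotForestSeparatrix.hotSeparatrix

/-- **F3 `CapturedEndConverges` (PROVABLE, M ⇐ V1; LOAD-BEARING).**  An injective complete hot leaf with `ω ≠ 0` along it, and a cluster point `q` with
`ω(q) = 0` at `+∞` (resp. `−∞`), CONVERGES to `q` at that end.  Proof (file header): V1 for `g := v₂(−1,·) − N` at `q` (analytic slice, tree
`IsTypeIAncientMild.analyticOnNhd_slice_univ`; `g|_{P₀} ≢ 0` near `q` by the no-interior hypothesis, `q` being hot as a limit of hot points); components of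
`γ⁻¹(B_r(q))` run in one half-branch, on which `dist(γ, q) = r·s` is continuous and injective, hence strictly monotone; bounded components are impossible
(`dist → r` at both ends), so the late returns lie in a component `[T, ∞)` along which `dist(γ τ, q) ↓ 0`. -/
def CapturedEndConverges : Prop :=
  ∀ (C : ℝ) (v : ℝ → EuclideanSpace ℝ (Fin 3) → EuclideanSpace ℝ (Fin 3)), Pinned C v →
    (∀ y ∈ hotSet v, ∀ r : ℝ, 0 < r →
      ∃ y' : EuclideanSpace ℝ (Fin 3), y' 2 = 0 ∧ dist y' y < r ∧ v (-1) y' 2 ≠ v (-1) 0 2) →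
    ∀ γ : ℝ → EuclideanSpace ℝ (Fin 3), (∀ τ : ℝ, HasDerivAt γ (Literature.Analysis.FluidPDE.curl (v (-1)) (γ τ)) τ) →
      (∀ τ : ℝ, γ τ ∈ hotSet v ∧ Literature.Analysis.FluidPDE.curl (v (-1)) (γ τ) ≠ 0) → Function.Injective γ →
      ∀ q : EuclideanSpace ℝ (Fin 3), Literature.Analysis.FluidPDE.curl (v (-1)) q = 0 →
        (MapClusterPt q Filter.atTop γ → Filter.Tendsto γ Filter.atTop (nhds q)) ∧
        (MapClusterPt q Filter.atBot γ → Filter.Tendsto γ Filter.atBot (nhds q))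

/-- **F3 ⇐ V1 BY NAME (v1.5)** — ns-es-p1 g7's p702676 `…Theorems.PoloidalWindowDoorPoloidalWindowRigidityHotForestCapturedEnd.capturedEndConverges_of_branches`
(core p702591 `…HotForestCapturedCore`: open partition by branch index, strict monotonicity of the distance along a branch). -/
theorem stub_capturedEndConverges_of_branches : PlanarZeroBranches → CapturedEndConverges :=
  Summit.NavierStokesRegularity.NavierStokesRegularity.Theorems.PoloidalWindowDoorPoloidalWindowRigidityHotForestCapturedEnd.capturedEndConverges_of_branches

/-- **F3 on this line** := (F3 ⇐ V1, by name) applied to V1 (by name, under the Literature hypothesis `hV1`) — the named fact sits in the cone of the kernel AS A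
HYPOTHESIS, not in a docstring and not as a sorry. -/
theorem capturedEndConverges_holds (hO : Literature.ModelTheory.ExponentialFields.VandendriesMiller1994_realAnExp_isOMinimal) : CapturedEndConverges :=
  stub_capturedEndConverges_of_branches (stub_planarZeroBranches hO)

/-! ## The two research cells of C2a′ on this line (OPEN) — every binder of `stub_cellC2aRidge` verbatim, then the forest structure in hand -/

/-- **Cell ESC-END `CellEscapingEnd` (OPEN, research).**  EVERY binder of C2a′ + the time pin on `H` (R10) + the Laplace sign on `H` (R9) + the no-cycle law
(F1a) and the separatrix law (F2) for this profile + the complete hot leaf `γ` through the arc's base point: global integral curve, hot and regular at every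
time with the ridge law `Δₕw(γ τ)‖ω(γ 0)‖² = Δₕw(γ 0)‖ω(γ τ)‖²`, the curtain law if Morse (`Δₕw(γ 0) ≠ 0`), injective, and ONE END leaving every compact set
⇒ `False`.  Why it might fail: the generic picture (a proper hot vortex half-line carrying `w = N`, `−σ∂_z p ≥ |N|/2`); the missing input is a Liouville /
zero-mode mechanism AT INFINITY along a curve (codimension 2 for box means, B-g8-4) or the ancient dynamics of the ridge; the 2.5-D toy of B-g9-6 sits here. -/
def CellEscapingEnd : Prop :=
  ∀ (C : ℝ) (v : ℝ → EuclideanSpace ℝ (Fin 3) → EuclideanSpace ℝ (Fin 3)) (W : Set (ℝ × EuclideanSpace ℝ (Fin 3))),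
    Pinned C v → ThickWindow v W → Peakless v →
    (∀ s < 0, ∀ y, ⟪fderiv ℝ (v s) y (Literature.Analysis.FluidPDE.curl (v s) y), EuclideanSpace.single 2 1⟫_ℝ = 0) →
    IsClosed (hotSet v) → (∀ y ∈ hotSet v, fderiv ℝ (fun x => v (-1) x 2) y = 0) →
    (∀ K O : Set (EuclideanSpace ℝ (Fin 3)), IsCompact K → K.Nonempty → K ⊆ hotSet v → IsOpen O → K ⊆ O →
      O ∩ hotSet v ⊆ K → False) →
    (∀ y ∈ hotSet v, ∀ r : ℝ, 0 < r →
      ∃ y' : EuclideanSpace ℝ (Fin 3), y' 2 = 0 ∧ dist y' y < r ∧ v (-1) y' 2 ≠ v (-1) 0 2) →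
    (∃ (γ : ℝ → EuclideanSpace ℝ (Fin 3)) (ε : ℝ), 0 < ε ∧ γ 0 ∈ hotSet v ∧
      Literature.Analysis.FluidPDE.curl (v (-1)) (γ 0) ≠ 0 ∧
      ∀ τ ∈ Set.Ioo (-ε) ε, HasDerivAt γ (Literature.Analysis.FluidPDE.curl (v (-1)) (γ τ)) τ ∧ γ τ ∈ hotSet v) →
    (∀ y ∈ hotSet v, deriv (fun s => v s y 2) (-1) = v (-1) 0 2 / 2) →
    (∀ y ∈ hotSet v, v (-1) 0 2 * lapH v y ≤ 0) →
    (∀ c : ℝ → EuclideanSpace ℝ (Fin 3), Continuous c → (∀ θ : ℝ, c (θ + 1) = c θ) → Set.InjOn c (Set.Ico 0 1) →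
      (∀ θ : ℝ, c θ ∈ hotSet v) → False) →
    (∀ γ : ℝ → EuclideanSpace ℝ (Fin 3), (∀ τ : ℝ, HasDerivAt γ (Literature.Analysis.FluidPDE.curl (v (-1)) (γ τ)) τ) →
      ∀ q ∈ hotSet v, (MapClusterPt q Filter.atTop γ ∨ MapClusterPt q Filter.atBot γ) → ∀ τ : ℝ, γ τ ∈ hotSet v) →
    (∃ γ : ℝ → EuclideanSpace ℝ (Fin 3), γ 0 ∈ hotSet v ∧ Literature.Analysis.FluidPDE.curl (v (-1)) (γ 0) ≠ 0 ∧
      (∀ τ : ℝ, HasDerivAt γ (Literature.Analysis.FluidPDE.curl (v (-1)) (γ τ)) τ) ∧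
      (∀ τ : ℝ, γ τ ∈ hotSet v ∧ Literature.Analysis.FluidPDE.curl (v (-1)) (γ τ) ≠ 0 ∧
        lapH v (γ τ) * ‖Literature.Analysis.FluidPDE.curl (v (-1)) (γ 0)‖ ^ 2 = lapH v (γ 0) * ‖Literature.Analysis.FluidPDE.curl (v (-1)) (γ τ)‖ ^ 2) ∧
      (lapH v (γ 0) ≠ 0 → ∀ τ : ℝ, curtain v (γ τ) = curtain v (γ 0)) ∧
      Function.Injective γ ∧
      (Filter.Tendsto γ Filter.atTop (Filter.cocompact (EuclideanSpace ℝ (Fin 3))) ∨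
        Filter.Tendsto γ Filter.atBot (Filter.cocompact (EuclideanSpace ℝ (Fin 3))))) →
    False

/-- **stub ESC-END** (OPEN, research). -/
theorem stub_cellEscapingEnd : CellEscapingEnd := by
  sorry

/-- **Cell CONVERGENT-WEB `CellConvergentWeb` (OPEN, research).**  EVERY binder of C2a′ + R10 + R9 + the no-cycle law (F1a) and the separatrix law (F2) for
this profile + the complete hot leaf `γ` through the arc's base point (global, hot and regular with the ridge law, curtain law if Morse, injective) which is
a bounded HETEROCLINIC hot connection: `γ → q⁺` at `+∞`, `γ → q⁻` at `−∞`, with `q^± ∈ H` vorticity zeros, horizontally flat, `q⁺ ≠ q⁻` ⇒ `False`.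
Why it might fail: a bounded hot saddle connection inside an unbounded hot tree is consistent with every finite jet and every leaf invariant; the missing
input is the ancient dynamics of a pinned heteroclinic vortex connection, or an induction through the web to infinity (every further vertex may be degenerate). -/
def CellConvergentWeb : Prop :=
  ∀ (C : ℝ) (v : ℝ → EuclideanSpace ℝ (Fin 3) → EuclideanSpace ℝ (Fin 3)) (W : Set (ℝ × EuclideanSpace ℝ (Fin 3))),
    Pinned C v → ThickWindow v W → Peakless v →
    (∀ s < 0, ∀ y, ⟪fderiv ℝ (v s) y (Literature.Analysis.FluidPDE.curl (v s) y), EuclideanSpace.single 2 1⟫_ℝ = 0) →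
    IsClosed (hotSet v) → (∀ y ∈ hotSet v, fderiv ℝ (fun x => v (-1) x 2) y = 0) →
    (∀ K O : Set (EuclideanSpace ℝ (Fin 3)), IsCompact K → K.Nonempty → K ⊆ hotSet v → IsOpen O → K ⊆ O →
      O ∩ hotSet v ⊆ K → False) →
    (∀ y ∈ hotSet v, ∀ r : ℝ, 0 < r →
      ∃ y' : EuclideanSpace ℝ (Fin 3), y' 2 = 0 ∧ dist y' y < r ∧ v (-1) y' 2 ≠ v (-1) 0 2) →
    (∃ (γ : ℝ → EuclideanSpace ℝ (Fin 3)) (ε : ℝ), 0 < ε ∧ γ 0 ∈ hotSet v ∧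
      Literature.Analysis.FluidPDE.curl (v (-1)) (γ 0) ≠ 0 ∧
      ∀ τ ∈ Set.Ioo (-ε) ε, HasDerivAt γ (Literature.Analysis.FluidPDE.curl (v (-1)) (γ τ)) τ ∧ γ τ ∈ hotSet v) →
    (∀ y ∈ hotSet v, deriv (fun s => v s y 2) (-1) = v (-1) 0 2 / 2) →
    (∀ y ∈ hotSet v, v (-1) 0 2 * lapH v y ≤ 0) →
    (∀ c : ℝ → EuclideanSpace ℝ (Fin 3), Continuous c → (∀ θ : ℝ, c (θ + 1) = c θ) → Set.InjOn c (Set.Ico 0 1) →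
      (∀ θ : ℝ, c θ ∈ hotSet v) → False) →
    (∀ γ : ℝ → EuclideanSpace ℝ (Fin 3), (∀ τ : ℝ, HasDerivAt γ (Literature.Analysis.FluidPDE.curl (v (-1)) (γ τ)) τ) →
      ∀ q ∈ hotSet v, (MapClusterPt q Filter.atTop γ ∨ MapClusterPt q Filter.atBot γ) → ∀ τ : ℝ, γ τ ∈ hotSet v) →
    (∃ (γ : ℝ → EuclideanSpace ℝ (Fin 3)) (qp qm : EuclideanSpace ℝ (Fin 3)),
      γ 0 ∈ hotSet v ∧ Literature.Analysis.FluidPDE.curl (v (-1)) (γ 0) ≠ 0 ∧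
      (∀ τ : ℝ, HasDerivAt γ (Literature.Analysis.FluidPDE.curl (v (-1)) (γ τ)) τ) ∧
      (∀ τ : ℝ, γ τ ∈ hotSet v ∧ Literature.Analysis.FluidPDE.curl (v (-1)) (γ τ) ≠ 0 ∧
        lapH v (γ τ) * ‖Literature.Analysis.FluidPDE.curl (v (-1)) (γ 0)‖ ^ 2 = lapH v (γ 0) * ‖Literature.Analysis.FluidPDE.curl (v (-1)) (γ τ)‖ ^ 2) ∧
      (lapH v (γ 0) ≠ 0 → ∀ τ : ℝ, curtain v (γ τ) = curtain v (γ 0)) ∧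
      Function.Injective γ ∧
      Filter.Tendsto γ Filter.atTop (nhds qp) ∧ Filter.Tendsto γ Filter.atBot (nhds qm) ∧
      qp ∈ hotSet v ∧ qm ∈ hotSet v ∧
      Literature.Analysis.FluidPDE.curl (v (-1)) qp = 0 ∧ Literature.Analysis.FluidPDE.curl (v (-1)) qm = 0 ∧
      HFlat v qp ∧ HFlat v qm ∧ qp ≠ qm) →
    False

/-- **stub CONVERGENT-WEB** (OPEN, research). -/
theorem stub_cellConvergentWeb : CellConvergentWeb := by
  sorry

/-! ## Kernel: C2a′ ⇐ R9 ∧ R10 ∧ R15 ∧ R16 ∧ R18 ∧ R19 ∧ R20 ∧ F1a ∧ F1b ∧ F2 ∧ F3 ∧ ESC-END ∧ CONVERGENT-WEB (sorry-free) -/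

/-- **KERNEL `cellC2aRidge_of_forest`** — the statement of hot_split's `stub_cellC2aRidge` (v1.6, VERBATIM) from the two forest cells; every structure stub
is consumed (V1 through `capturedEndConverges_holds`).  Logic only: extend the arc to a complete leaf (R15/R16), get injectivity and the end dichotomy (R18/R19);
an escaping end is ESC-END; two clustering ends converge (F3) to hot flat vertices (R19/R20), distinct by F1b (the leaf never meets a vorticity zero) —
CONVERGENT-WEB, which is also handed F1a and F2. -/
theorem cellC2aRidge_of_forest (hR9 : HotLapSign) (hR10 : HotTimePin) (hR15 : VortexLineGlobal) (hR16 : LeafGlobalLaw) (hR18 : HotRegularAlone)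
    (hR19 : LeafEnds) (hR20 : HotFlatPointHFlat) (hF1a : NoHotCycle) (hF1b : NoHotLoop) (hF2 : HotSeparatrix) (hF3 : CapturedEndConverges)
    (hEsc : CellEscapingEnd) (hWeb : CellConvergentWeb) :
    ∀ (C : ℝ) (v : ℝ → EuclideanSpace ℝ (Fin 3) → EuclideanSpace ℝ (Fin 3)) (W : Set (ℝ × EuclideanSpace ℝ (Fin 3))),
      Pinned C v → ThickWindow v W → Peakless v →
      (∀ s < 0, ∀ y, ⟪fderiv ℝ (v s) y (Literature.Analysis.FluidPDE.curl (v s) y), EuclideanSpace.single 2 1⟫_ℝ = 0) →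
      IsClosed (hotSet v) → (∀ y ∈ hotSet v, fderiv ℝ (fun x => v (-1) x 2) y = 0) →
      (∀ K O : Set (EuclideanSpace ℝ (Fin 3)), IsCompact K → K.Nonempty → K ⊆ hotSet v → IsOpen O → K ⊆ O →
        O ∩ hotSet v ⊆ K → False) →
      (∀ y ∈ hotSet v, ∀ r : ℝ, 0 < r →
        ∃ y' : EuclideanSpace ℝ (Fin 3), y' 2 = 0 ∧ dist y' y < r ∧ v (-1) y' 2 ≠ v (-1) 0 2) →
      (∃ (γ : ℝ → EuclideanSpace ℝ (Fin 3)) (ε : ℝ), 0 < ε ∧ γ 0 ∈ hotSet v ∧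
        Literature.Analysis.FluidPDE.curl (v (-1)) (γ 0) ≠ 0 ∧
        ∀ τ ∈ Set.Ioo (-ε) ε, HasDerivAt γ (Literature.Analysis.FluidPDE.curl (v (-1)) (γ τ)) τ ∧ γ τ ∈ hotSet v) →
      False := by
  intro C v W hP hT hK hFL hcl hcrit hR3 hR4 harc
  obtain ⟨γ₀, ε, hε, hγ0, hω0, hγ⟩ := harc
  obtain ⟨γ, hγ0', hγ'⟩ := hR15 C v hP (γ₀ 0)
  have hγ0mem : γ 0 ∈ hotSet v := by rw [hγ0']; exact hγ0
  have hω0' : Literature.Analysis.FluidPDE.curl (v (-1)) (γ 0) ≠ 0 := by rw [hγ0']; exact hω0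
  obtain ⟨hridge, hcurt⟩ := hR16 C v hP hFL hcrit γ hγ' hγ0mem hω0'
  have hpin : ∀ y ∈ hotSet v, deriv (fun s => v s y 2) (-1) = v (-1) 0 2 / 2 := hR10 C v hP
  have hlap : ∀ y ∈ hotSet v, v (-1) 0 2 * lapH v y ≤ 0 := hR9 C v hP
  have hcyc := hF1a C v hP hK hR4
  have hsep := hF2 C v hP hFL
  have halone := hR18 C v hP hFL hR4
  obtain ⟨hinj, htop, hbot⟩ := hR19 C v hP hcl hR3 halone γ hγ' hridge
  have hreg : ∀ τ : ℝ, γ τ ∈ hotSet v ∧ Literature.Analysis.FluidPDE.curl (v (-1)) (γ τ) ≠ 0 :=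
    fun τ => ⟨(hridge τ).1, (hridge τ).2.1⟩
  have hconv := hF3 C v hP hR4 γ hγ' hreg hinj
  have hγc : Continuous γ := continuous_iff_continuousAt.mpr fun τ => (hγ' τ).continuousAt
  rcases htop with htop | ⟨qp, hqp, hqpH, hqpω, hqpL⟩
  · exact hEsc C v W hP hT hK hFL hcl hcrit hR3 hR4 ⟨γ₀, ε, hε, hγ0, hω0, hγ⟩ hpin hlap hcyc hsep
      ⟨γ, hγ0mem, hω0', hγ', hridge, hcurt, hinj, Or.inl htop⟩
  · rcases hbot with hbot | ⟨qm, hqm, hqmH, hqmω, hqmL⟩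
    · exact hEsc C v W hP hT hK hFL hcl hcrit hR3 hR4 ⟨γ₀, ε, hε, hγ0, hω0, hγ⟩ hpin hlap hcyc hsep
        ⟨γ, hγ0mem, hω0', hγ', hridge, hcurt, hinj, Or.inr hbot⟩
    · have htp : Filter.Tendsto γ Filter.atTop (nhds qp) := (hconv qp hqpω).1 hqp
      have hbt : Filter.Tendsto γ Filter.atBot (nhds qm) := (hconv qm hqmω).2 hqm
      have hne : qp ≠ qm := by
        intro heq
        have hbt' : Filter.Tendsto γ Filter.atBot (nhds qp) := by rw [heq]; exact hbt
        have havoid : ∀ τ : ℝ, γ τ ≠ qp := fun τ h => (hreg τ).2 (by rw [h]; exact hqpω)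
        exact hF1b C v hP hK hR4 γ hγc hinj (fun τ => (hreg τ).1) qp havoid htp hbt'
      exact hWeb C v W hP hT hK hFL hcl hcrit hR3 hR4 ⟨γ₀, ε, hε, hγ0, hω0, hγ⟩ hpin hlap hcyc hsep
        ⟨γ, qp, qm, hγ0mem, hω0', hγ', hridge, hcurt, hinj, htp, hbt, hqpH, hqmH, hqpω, hqmω,
          hR20 C v hP qp hqpH hqpL, hR20 C v hP qm hqmH hqmL, hne⟩

/-- **Residue C2a′ (hot_split `stub_cellC2aRidge`, VERBATIM statement) on this line** ⇐ R9 ∧ R10 ∧ R15 ∧ R16 ∧ R18 ∧ R19 ∧ R20 ∧ F1a ∧ F1b ∧ F2 ∧ F3 ∧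
ESC-END ∧ CONVERGENT-WEB. -/
theorem stub_cellC2aRidge (hO : Literature.ModelTheory.ExponentialFields.VandendriesMiller1994_realAnExp_isOMinimal) :
    ∀ (C : ℝ) (v : ℝ → EuclideanSpace ℝ (Fin 3) → EuclideanSpace ℝ (Fin 3)) (W : Set (ℝ × EuclideanSpace ℝ (Fin 3))),
      Pinned C v → ThickWindow v W → Peakless v →
      (∀ s < 0, ∀ y, ⟪fderiv ℝ (v s) y (Literature.Analysis.FluidPDE.curl (v s) y), EuclideanSpace.single 2 1⟫_ℝ = 0) →
      IsClosed (hotSet v) → (∀ y ∈ hotSet v, fderiv ℝ (fun x => v (-1) x 2) y = 0) →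
      (∀ K O : Set (EuclideanSpace ℝ (Fin 3)), IsCompact K → K.Nonempty → K ⊆ hotSet v → IsOpen O → K ⊆ O →
        O ∩ hotSet v ⊆ K → False) →
      (∀ y ∈ hotSet v, ∀ r : ℝ, 0 < r →
        ∃ y' : EuclideanSpace ℝ (Fin 3), y' 2 = 0 ∧ dist y' y < r ∧ v (-1) y' 2 ≠ v (-1) 0 2) →
      (∃ (γ : ℝ → EuclideanSpace ℝ (Fin 3)) (ε : ℝ), 0 < ε ∧ γ 0 ∈ hotSet v ∧
        Literature.Analysis.FluidPDE.curl (v (-1)) (γ 0) ≠ 0 ∧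
        ∀ τ ∈ Set.Ioo (-ε) ε, HasDerivAt γ (Literature.Analysis.FluidPDE.curl (v (-1)) (γ τ)) τ ∧ γ τ ∈ hotSet v) →
      False :=
  cellC2aRidge_of_forest stub_hotLapSign stub_hotTimePin stub_vortexLineGlobal stub_leafGlobalLaw stub_hotRegularAlone stub_leafEnds
    stub_hotFlatPointHFlat stub_noHotCycle stub_noHotLoop stub_hotSeparatrix (capturedEndConverges_holds hO) stub_cellEscapingEnd stub_cellConvergentWeb

/-! ## The other residue and the shared research stubs (VERBATIM hot_split v1.6) -/


/-- **Residue C2b′ `stub_cellC2bRidge` — THE NULL RIDGE ⇒ ∅ (OPEN, research) — VERBATIM hot_split v1.6.**  Not touched by this line. -/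
theorem stub_cellC2bRidge :
    ∀ (C : ℝ) (v : ℝ → EuclideanSpace ℝ (Fin 3) → EuclideanSpace ℝ (Fin 3)) (W : Set (ℝ × EuclideanSpace ℝ (Fin 3))),
      Pinned C v → ThickWindow v W → Peakless v →
      (∀ s < 0, ∀ y, ⟪fderiv ℝ (v s) y (Literature.Analysis.FluidPDE.curl (v s) y), EuclideanSpace.single 2 1⟫_ℝ = 0) →
      IsClosed (hotSet v) → (∀ y ∈ hotSet v, fderiv ℝ (fun x => v (-1) x 2) y = 0) →
      (∀ K O : Set (EuclideanSpace ℝ (Fin 3)), IsCompact K → K.Nonempty → K ⊆ hotSet v → IsOpen O → K ⊆ O →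
        O ∩ hotSet v ⊆ K → False) →
      (∀ y ∈ hotSet v, ∀ r : ℝ, 0 < r →
        ∃ y' : EuclideanSpace ℝ (Fin 3), y' 2 = 0 ∧ dist y' y < r ∧ v (-1) y' 2 ≠ v (-1) 0 2) →
      (∀ y ∈ hotSet v, Literature.Analysis.FluidPDE.curl (v (-1)) y = 0) →
      False := by
  sorry

/-- **SHARED STUB S0 ((TH) column) — VERBATIM `stub_localTHEmptyHypNUGRS`** (twist_split = hot_loops v4.3 = loop_island = hot_split). -/
theorem stub_localTHEmptyHypNUGRS :
    ∀ (u : ℝ → EuclideanSpace ℝ (Fin 3) → EuclideanSpace ℝ (Fin 3)) (μ A : ℝ → ℝ → ℝ)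
      (U : Set (ℝ × EuclideanSpace ℝ (Fin 3))) (p₀ : ℝ × EuclideanSpace ℝ (Fin 3)),
      IsOpen U → p₀ ∈ U →
      AnalyticOnNhd ℝ (Function.uncurry u) U →
      (∀ p ∈ U, AnalyticAt ℝ (Function.uncurry μ) (p.1, p.2 2)) →
      (∀ p ∈ U, AnalyticAt ℝ (Function.uncurry A) (p.1, p.2 2)) →
      (∀ p ∈ U, fderiv ℝ (u p.1) p.2 (EuclideanSpace.single 0 1) 1 = fderiv ℝ (u p.1) p.2 (EuclideanSpace.single 1 1) 0) →
      (∀ p ∈ U, fderiv ℝ (u p.1) p.2 (EuclideanSpace.single 0 1) 0 + fderiv ℝ (u p.1) p.2 (EuclideanSpace.single 1 1) 1 +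
        fderiv ℝ (u p.1) p.2 (EuclideanSpace.single 2 1) 2 = 0) →
      (∀ p ∈ U, ∀ b : Fin 3, b ≠ 2 →
        fderiv ℝ (u p.1) p.2 (EuclideanSpace.single 2 1) b =
          μ p.1 (p.2 2) * fderiv ℝ (u p.1) p.2 (EuclideanSpace.single b 1) 2) →
      (∀ p ∈ U,
        (1 - μ p.1 (p.2 2)) *
            (deriv (fun s => u s p.2 2) p.1 + fderiv ℝ (fun y => u p.1 y 2) p.2 (u p.1 p.2)
              - Δ (fun y => u p.1 y 2) p.2) =
          A p.1 (p.2 2) + (deriv (fun s => μ s (p.2 2)) p.1 - deriv (deriv (μ p.1)) (p.2 2)) * u p.1 p.2 2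
            + deriv (μ p.1) (p.2 2) / 2 * u p.1 p.2 2 ^ 2
            - 2 * deriv (μ p.1) (p.2 2) * fderiv ℝ (u p.1) p.2 (EuclideanSpace.single 2 1) 2) →
      fderiv ℝ (fun y => fderiv ℝ (u p₀.1) y (EuclideanSpace.single 2 1) 2) p₀.2 (EuclideanSpace.single 0 1) *
            fderiv ℝ (u p₀.1) p₀.2 (EuclideanSpace.single 1 1) 2 -
          fderiv ℝ (fun y => fderiv ℝ (u p₀.1) y (EuclideanSpace.single 2 1) 2) p₀.2 (EuclideanSpace.single 1 1) *
            fderiv ℝ (u p₀.1) p₀.2 (EuclideanSpace.single 0 1) 2 ≠ 0 →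
      μ p₀.1 (p₀.2 2) ≠ 0 → μ p₀.1 (p₀.2 2) ≠ 1 → deriv (μ p₀.1) (p₀.2 2) ≠ 0 →
      μ p₀.1 (p₀.2 2) < 0 →
      (fderiv ℝ (u p₀.1) p₀.2 (EuclideanSpace.single 0 1) 0 ≠ fderiv ℝ (u p₀.1) p₀.2 (EuclideanSpace.single 1 1) 1 ∨
        fderiv ℝ (u p₀.1) p₀.2 (EuclideanSpace.single 1 1) 0 ≠ 0) →
      u p₀.1 p₀.2 = 0 →
      fderiv ℝ (u p₀.1) p₀.2 (EuclideanSpace.single 0 1) 2 = 0 →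
      fderiv ℝ (u p₀.1) p₀.2 (EuclideanSpace.single 1 1) 2 = 1 → False := by
  sorry

/-- **THE WALL ⟨27893⟩ BY NAME (`stub_wall`)** — item `LoopPeriodRatchet.FrequencyGrowthExponent` (rank 2, OPEN); feeds the landed reduction only. -/
theorem stub_wall : FrequencyGrowthExponent := by
  sorry

/-! ## Kernel: HL3′ ⇐ cells, with A1, C1, C2a ⇐ C2a′, C2b ⇐ C2b′ ALL BY NAME from Theorems (K2-p2 g12/g13 landings) -/

/-- **HL3′ (the statement of `stub_peaklessEmpty`, hot_loops v4.3 / hot_split, VERBATIM) on this line**: hot_split's trichotomy with A1 :=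
`…HotPlaneConst.stub_hotPlaneConst`, C1 := `…ZeroModeNoHotPlane.hotSplit_cellC1`, C2a := `…HotSplitRidgeKernels.cellC2a_of_ridge stub_cellC2aRidge`,
C2b := `…HotSplitRidgeKernels.cellC2b_of_ridge stub_cellC2bRidge`, the frozen law from `…FirstIntegral.stub_firstIntegral`.  Kernel-checked. -/
theorem hotForest_peaklessEmpty (hO : Literature.ModelTheory.ExponentialFields.VandendriesMiller1994_realAnExp_isOMinimal) :
    ∀ (C : ℝ) (v : ℝ → EuclideanSpace ℝ (Fin 3) → EuclideanSpace ℝ (Fin 3)),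
      Literature.Analysis.FluidPDE.HasTypeITimeDecay C v →
      ContinuousOn (Function.uncurry v) (Set.Iio (0 : ℝ) ×ˢ Set.univ) →
      (∀ s t : ℝ, s < t → t < 0 → ∀ x, v t x =
        Literature.Analysis.UnboundedOperators.heatExtension (v s) (t - s) x -
          Literature.Analysis.FluidPDE.oseenDuhamel 1 s v v t x) →
      (∀ t < 0, Literature.Analysis.FluidPDE.VectorCalculus.IsDivFree (v t)) →
      (∀ s < 0, ∀ y, ⟪Literature.Analysis.FluidPDE.curl (v s) y, EuclideanSpace.single 2 1⟫_ℝ = 0) →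
      v (-1) 0 2 ≠ 0 → (∀ t < 0, ∀ x, Real.sqrt (-t) * |v t x 2| ≤ |v (-1) 0 2|) →
      (∀ h : EuclideanSpace ℝ (Fin 3), fderiv ℝ (v (-1)) 0 h 2 = 0) →
      (deriv (fun s => v s 0 2) (-1) = v (-1) 0 2 / 2 ∧ v (-1) 0 2 * (Δ (fun y => v (-1) y 2)) 0 ≤ 0) →
      ∀ W : Set (ℝ × EuclideanSpace ℝ (Fin 3)), IsOpen W → W ⊆ Set.Iio (0 : ℝ) ×ˢ Set.univ →
        (∀ z ∈ W, (Literature.Analysis.FluidPDE.curl (v z.1) z.2 ≠ 0 ∧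
            (fderiv ℝ (v z.1) z.2 (EuclideanSpace.single 0 1) 2 ≠ 0 ∨ fderiv ℝ (v z.1) z.2 (EuclideanSpace.single 1 1) 2 ≠ 0) ∧
            (fderiv ℝ (v z.1) z.2 (EuclideanSpace.single 2 1) 0 ≠ 0 ∨ fderiv ℝ (v z.1) z.2 (EuclideanSpace.single 2 1) 1 ≠ 0)) ∧
          (fderiv ℝ (fun x => fderiv ℝ (v z.1) x (EuclideanSpace.single 2 1) 2) z.2 (EuclideanSpace.single 0 1) *
                fderiv ℝ (v z.1) z.2 (EuclideanSpace.single 1 1) 2 -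
              fderiv ℝ (fun x => fderiv ℝ (v z.1) x (EuclideanSpace.single 2 1) 2) z.2 (EuclideanSpace.single 1 1) *
                fderiv ℝ (v z.1) z.2 (EuclideanSpace.single 0 1) 2 ≠ 0)) →
        (∀ m : ℝ → ℝ → ℝ, ∀ W₁ : Set (ℝ × EuclideanSpace ℝ (Fin 3)), W₁ ⊆ W → IsOpen W₁ → W₁.Nonempty →
            ∃ z ∈ W₁, ∃ b : Fin 3, b ≠ 2 ∧
              fderiv ℝ (v z.1) z.2 (EuclideanSpace.single 2 1) b ≠
                m z.1 (z.2 2) * fderiv ℝ (v z.1) z.2 (EuclideanSpace.single b 1) 2) →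
        (∀ r : ℝ, 0 < r → (Metric.ball ((-1 : ℝ), (0 : EuclideanSpace ℝ (Fin 3))) r ∩ W).Nonempty) →
        (∀ (s z₀ σ M : ℝ) (K O : Set (EuclideanSpace ℝ (Fin 3))), s < 0 →
          ((σ = 1 ∨ σ = -1) ∧ IsCompact K ∧ K.Nonempty ∧ (∀ y ∈ K, y 2 = z₀ ∧ σ * v s y 2 = M) ∧
            IsOpen O ∧ K ⊆ O ∧ (∀ y ∈ O, y 2 = z₀ → σ * v s y 2 ≤ M) ∧
            (∀ y ∈ O, y 2 = z₀ → σ * v s y 2 = M → y ∈ K)) → False) →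
        False :=
  -- v1.1 (critic A1): HL3′ ⇐ C2a′ ∧ C2b′ BY NAME through the tree's `…HotSplitCells.peaklessEmpty_of_ridges` (K2-p2 g13, p690711);
  -- `Pinned`/`ThickWindow`/`Peakless`/`hotSet` unfold definitionally to the Theorems file's verbatim binders.
  PoloidalWindowDoorPoloidalWindowRigidityHotSplitCells.peaklessEmpty_of_ridges (stub_cellC2aRidge hO) stub_cellC2bRidge

/-! ## Compositions to the crux items BY NAME -/

/-- **The crux `PoloidalWindowRigidity` (K2, stmt-NavierStokesRegularity-19708) BY NAME ⇐ S0 ∧ ⟨27893⟩ ∧ (R9,R10,R15,R16,R18–R20,F1–F3, ESC-END, CONVERGENT-WEB) ∧ C2b′**: tree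
`…HotSplitComposition.poloidalWindowRigidity_of_residues` (v1.1; v1 went through `…HotLoopsReduction…` + this file's HL3′).  CONDITIONAL; no summit is proved. -/
theorem PoloidalWindowRigidity_of_hotForest (hO : Literature.ModelTheory.ExponentialFields.VandendriesMiller1994_realAnExp_isOMinimal) :
    Summit.NavierStokesRegularity.NavierStokesRegularity.Theses.PoloidalWindowDoor.PoloidalWindowRigidity :=
  -- v1.1 (critic A1): `hotForest_peaklessEmpty` is HL3′ BY NAME through `…HotSplitCells.peaklessEmpty_of_ridges`; this term is definitionally the tree's
  -- `…HotSplitComposition.poloidalWindowRigidity_of_residues stub_localTHEmptyHypNUGRS stub_wall stub_cellC2aRidge stub_cellC2bRidge` (see the `example`s below).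
  PoloidalWindowDoorPoloidalWindowRigidityHotLoopsReduction.poloidalWindowRigidity_of_NUGRS_of_growth_of_peakless
    stub_localTHEmptyHypNUGRS stub_wall (hotForest_peaklessEmpty hO)

/-- **The item `LrcModEntire` (stmt-NavierStokesRegularity-20428) BY NAME ⇐ S0 ∧ ⟨27893⟩ ∧ (R9,R10,R15,R16,R18–R20,F1–F3, ESC-END, CONVERGENT-WEB) ∧ C2b′.** CONDITIONAL. -/
theorem LrcModEntire_of_hotForest (hO : Literature.ModelTheory.ExponentialFields.VandendriesMiller1994_realAnExp_isOMinimal) :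
    Summit.NavierStokesRegularity.NavierStokesRegularity.Theses.PoloidalWindowDoor.LrcModEntire :=
  PoloidalWindowDoorPoloidalWindowRigidityHotLoopsReduction.lrcModEntire_of_NUGRS_of_growth_of_peakless
    stub_localTHEmptyHypNUGRS stub_wall (hotForest_peaklessEmpty hO)

/-- v1.1 (critic A1): the same two compositions through the tree's `…HotSplitComposition…_of_residues` BY NAME (S0, wall, C2a′, C2b′ — the residue of
this line being the DERIVED one); `example`s, so the census reads them and the audit counts no duplicate items. -/
example (hO : Literature.ModelTheory.ExponentialFields.VandendriesMiller1994_realAnExp_isOMinimal) :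
    Summit.NavierStokesRegularity.NavierStokesRegularity.Theses.PoloidalWindowDoor.PoloidalWindowRigidity :=
  PoloidalWindowDoorPoloidalWindowRigidityHotSplitComposition.poloidalWindowRigidity_of_residues
    stub_localTHEmptyHypNUGRS stub_wall (stub_cellC2aRidge hO) stub_cellC2bRidge

example (hO : Literature.ModelTheory.ExponentialFields.VandendriesMiller1994_realAnExp_isOMinimal) :
    Summit.NavierStokesRegularity.NavierStokesRegularity.Theses.PoloidalWindowDoor.LrcModEntire :=
  PoloidalWindowDoorPoloidalWindowRigidityHotSplitComposition.lrcModEntire_of_residues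
    stub_localTHEmptyHypNUGRS stub_wall (stub_cellC2aRidge hO) stub_cellC2bRidge

end Summit.NavierStokesRegularity.NavierStokesRegularity.Cruxes.PoloidalWindowRigidity.HotForest
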